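import Literature.Dynamics.ConleyIndex.Semiflow
import Literature.AlgebraicTopology.Homotopy.StrongDeformationRetract
import Mathlib.Topology.MetricSpace.Pseudo.Lemmas
import Mathlib.Order.ConditionallyCompleteLattice.Indexed
import HarnessLib

/-!
# Ważewski's theorem (Conley's statement) for continuous semiflows, and the retract principle

Topic `Literature/Dynamics/ConleyIndex`; continues `Semiflow.lean` (`IsSemiflow φ`,
`eventualExitSet φ W = W⁰`, `immediateExitSet φ W = W⁻`, `IsWazewskiSet φ W`).  Everything here is
PROVED; the source is Conley's half-page proof [Conley1976, §1, Thm. 1.3, pp. 61–62], stated there for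
two-sided flows on a topological space but using forward times only, hence valid verbatim for
semiflows.

* `exitTime φ W x = τ(x) := sup {t ≥ 0 | x·[0, t] ⊆ W}` and its calculus on `W⁰` for a Ważewski
  set: `x·[0, τ x] ⊆ W` (uses condition (a) and continuity), `x·τ(x) ∈ W⁻`, `τ = 0` on `W⁻`,
  `x·[0, τ x] ⊆ W⁰`; upper semicontinuity (and `W⁰` relatively open in `W`) from continuity of the
  time-`t'` map at a point pushed out of `cl W`; lower semicontinuity from condition (b) by Conley's
  `t̄ = inf {t | x is a limit of points y ∈ W⁰ with τ(y) ≤ t}` argument; hence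
  `IsWazewskiSet.continuousOn_exitTime : ContinuousOn τ W⁰`.
* **`IsWazewskiSet.isStrongDeformationRetractOf`** (Ważewski's theorem, [Conley1976, Thm. 1.3]):
  `W⁻` is a strong deformation retract of `W⁰` (tree notion
  `Literature.AlgebraicTopology.Homotopy.IsStrongDeformationRetractOf`, deformation
  `(σ, x) ↦ x·(σ τ(x))`), and **`IsWazewskiSet.exists_isOpen_inter_eq`**: `W⁰` is open in `W`.
* **`IsWazewskiSet.exists_forall_mem`** (Ważewski's principle as Conley uses it, [Conley1976,
  pp. 62–63]): if `W⁻` is not a strong deformation retract of `W` then `W ∖ W⁰ ≠ ∅`, i.e. some forward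
  orbit stays in `W`; and the RETRACT form **`IsSemiflow.exists_forall_mem_of_not_retract`**: for
  `W` closed with `W⁻` closed, if there is no retraction `W → W⁻` (continuous on `W`, into `W⁻`,
  fixing `W⁻`) then `∃ x ∈ W, ∀ t ≥ 0, φ t x ∈ W` — literally the shape of the route item
  `Summit.AnomalousDissipation.AnomalousDissipation.Theses.WazewskiBlock.WazewskiRetract`
  [Wazewski1947; Conley1978, Ch. II; HaleMagalhaesOliva2002, App. A, p. 243].
-/

open Set Filter
open scoped Topology

namespace Literature.Dynamics.ConleyIndex

variable {X : Type*}

/-! ### The exit time -/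

/-- The set of times `t ≥ 0` up to which the forward orbit of `x` stays in `W`:
`{t ≥ 0 | x·[0, t] ⊆ W}`. [cite: Conley1976, §1, proof of Thm. 1.3, pp. 61–63] -/
def stayTimes (φ : ℝ → X → X) (W : Set X) (x : X) : Set ℝ :=
  {t : ℝ | 0 ≤ t ∧ ∀ s ∈ Icc 0 t, φ s x ∈ W}

/-- Conley's **exit time** `τ(x) := sup {t ≥ 0 | x·[0, t] ⊆ W}` (a real number; meaningful for
`x ∈ W⁰`, where the set is nonempty and bounded; junk elsewhere).
[cite: Conley1976, §1, proof of Thm. 1.3, pp. 61–63] -/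
noncomputable def exitTime (φ : ℝ → X → X) (W : Set X) (x : X) : ℝ :=
  sSup (stayTimes φ W x)

section Order

variable {φ : ℝ → X → X} {W : Set X} {x : X}

/-- `stayTimes` is down-closed in `[0, ∞)`. [folklore] -/
theorem mem_stayTimes_of_le {s t : ℝ} (ht : t ∈ stayTimes φ W x) (h0s : 0 ≤ s) (hst : s ≤ t) :
    s ∈ stayTimes φ W x :=
  ⟨h0s, fun u hu => ht.2 u ⟨hu.1, hu.2.trans hst⟩⟩

/-- A stay time is smaller than any nonnegative time at which the orbit is outside `W`.
[folklore] -/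
theorem lt_of_mem_stayTimes {t t₀ : ℝ} (ht : t ∈ stayTimes φ W x) (ht₀ : 0 ≤ t₀)
    (hout : φ t₀ x ∉ W) : t < t₀ := by
  by_contra h
  exact hout (ht.2 t₀ ⟨ht₀, not_lt.1 h⟩)

/-- For `x ∈ W⁰` the stay times are bounded above. [folklore] -/
theorem bddAbove_stayTimes (hx : x ∈ eventualExitSet φ W) : BddAbove (stayTimes φ W x) := by
  obtain ⟨t₀, ht₀, hout⟩ := hx.2
  exact ⟨t₀, fun t ht => (lt_of_mem_stayTimes ht ht₀.le hout).le⟩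

end Order

variable [TopologicalSpace X] {φ : ℝ → X → X} {W : Set X} {x : X}

namespace IsSemiflow

/-- `0` is a stay time of every point of `W`. [folklore] -/
theorem zero_mem_stayTimes (hφ : IsSemiflow φ) (hx : x ∈ W) : 0 ∈ stayTimes φ W x := by
  refine ⟨le_rfl, fun s hs => ?_⟩
  rw [le_antisymm hs.2 hs.1, hφ.map_zero]
  exact hx

/-- `0 ≤ τ(x)` for `x ∈ W⁰`. [folklore] -/
theorem exitTime_nonneg (hφ : IsSemiflow φ) (hx : x ∈ eventualExitSet φ W) :
    0 ≤ exitTime φ W x :=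
  le_csSup (bddAbove_stayTimes hx) (hφ.zero_mem_stayTimes hx.1)

/-- `τ(x) ≤ t₀` whenever `x·t₀ ∉ W`, `t₀ ≥ 0` (`x ∈ W`). [folklore] -/
theorem exitTime_le_of_not_mem (hφ : IsSemiflow φ) (hx : x ∈ W) {t₀ : ℝ} (ht₀ : 0 ≤ t₀)
    (hout : φ t₀ x ∉ W) : exitTime φ W x ≤ t₀ :=
  csSup_le ⟨0, hφ.zero_mem_stayTimes hx⟩ fun _ ht => (lt_of_mem_stayTimes ht ht₀ hout).le

/-- Before the exit time the orbit is in `W`: `x·s ∈ W` for `0 ≤ s < τ(x)` (`x ∈ W`). [folklore] -/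
theorem mem_of_lt_exitTime (hφ : IsSemiflow φ) (hx : x ∈ W) {s : ℝ} (h0s : 0 ≤ s)
    (hs : s < exitTime φ W x) : φ s x ∈ W := by
  obtain ⟨t, ht, hst⟩ := exists_lt_of_lt_csSup ⟨0, hφ.zero_mem_stayTimes hx⟩ hs
  exact ht.2 s ⟨h0s, hst.le⟩

/-- On `W⁻` the exit time vanishes. [folklore] -/
theorem exitTime_eq_zero (hφ : IsSemiflow φ) (hx : x ∈ immediateExitSet φ W) :
    exitTime φ W x = 0 := by
  have hS : stayTimes φ W x = {0} := by
    refine Subset.antisymm (fun t ht => ?_) ?_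
    · rcases ht.1.eq_or_lt with h | h
      · exact h.symm
      · obtain ⟨s, hs, hout⟩ := hx.2 t h
        exact absurd (ht.2 s ⟨hs.1.le, hs.2.le⟩) hout
    · rintro t rfl
      exact hφ.zero_mem_stayTimes hx.1
  rw [exitTime, hS, csSup_singleton]

end IsSemiflow

namespace IsWazewskiSet

/-- **The orbit stays in `W` up to and including the exit time**: for a Ważewski set and
`x ∈ W⁰`, `x·[0, τ(x)] ⊆ W`.  (`x·[0, τ x) ⊆ W` by definition of the supremum; the end point is a
limit of these, so `x·[0, τ x] ⊆ cl W`, and condition (a) applies.)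
[cite: Conley1976, §1, proof of Thm. 1.3, pp. 61–63] -/
theorem mem_of_le_exitTime (hW : IsWazewskiSet φ W) (hφ : IsSemiflow φ)
    (hx : x ∈ eventualExitSet φ W) {s : ℝ} (hs : s ∈ Icc 0 (exitTime φ W x)) : φ s x ∈ W := by
  set τ := exitTime φ W x with hτ
  have hτ0 : 0 ≤ τ := hφ.exitTime_nonneg hx
  refine hW.1 x hx.1 τ hτ0 (fun u hu => ?_) s hs
  rcases hu.2.eq_or_lt with h | h
  · -- the end point `u = τ`
    rw [h]
    rcases hτ0.eq_or_lt with h0 | hpos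
    · rw [← h0, hφ.map_zero]; exact subset_closure hx.1
    · have hcont : ContinuousWithinAt (fun r => φ r x) (Ico 0 τ) τ :=
        (hφ.continuousWithinAt_orbit x hτ0).mono Ico_subset_Ici_self
      have hcl : τ ∈ closure (Ico 0 τ) := by
        rw [closure_Ico hpos.ne]; exact right_mem_Icc.2 hτ0
      refine closure_mono ?_ (hcont.mem_closure_image hcl)
      rintro _ ⟨r, hr, rfl⟩
      exact hφ.mem_of_lt_exitTime hx.1 hr.1 hr.2
  · exact subset_closure (hφ.mem_of_lt_exitTime hx.1 hu.1 h)

/-- **The exit point leaves immediately**: `x·τ(x) ∈ W⁻` for `x ∈ W⁰`.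
[cite: Conley1976, §1, proof of Thm. 1.3, pp. 61–63] -/
theorem apply_exitTime_mem (hW : IsWazewskiSet φ W) (hφ : IsSemiflow φ)
    (hx : x ∈ eventualExitSet φ W) : φ (exitTime φ W x) x ∈ immediateExitSet φ W := by
  set τ := exitTime φ W x with hτ
  have hτ0 : 0 ≤ τ := hφ.exitTime_nonneg hx
  refine ⟨hW.mem_of_le_exitTime hφ hx ⟨hτ0, le_rfl⟩, fun δ hδ => ?_⟩
  -- `τ + δ/2` is not a stay time
  have hnot : τ + δ / 2 ∉ stayTimes φ W x := fun h => by
    have : τ + δ / 2 ≤ τ := by rw [hτ]; exact le_csSup (bddAbove_stayTimes hx) h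
    linarith
  simp only [stayTimes, mem_setOf_eq, not_and, not_forall] at hnot
  obtain ⟨s, hs, hout⟩ := hnot (by linarith)
  have hτs : τ < s := by
    by_contra h
    exact hout (hW.mem_of_le_exitTime hφ hx ⟨hs.1, not_lt.1 h⟩)
  refine ⟨s - τ, ⟨by linarith, by linarith [hs.2]⟩, ?_⟩
  rwa [← hφ.map_add (s - τ) τ (by linarith) hτ0, sub_add_cancel]

/-- Up to the exit time the orbit of a point of `W⁰` stays in `W⁰`. [folklore] -/
theorem apply_mem_eventualExitSet (hW : IsWazewskiSet φ W) (hφ : IsSemiflow φ)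
    (hx : x ∈ eventualExitSet φ W) {s : ℝ} (hs : s ∈ Icc 0 (exitTime φ W x)) :
    φ s x ∈ eventualExitSet φ W := by
  refine ⟨hW.mem_of_le_exitTime hφ hx hs, ?_⟩
  obtain ⟨t₀, ht₀, hout⟩ := hx.2
  have hst₀ : s < t₀ := by
    by_contra h
    exact hout (hW.mem_of_le_exitTime hφ hx ⟨ht₀.le, (not_lt.1 h).trans hs.2⟩)
  refine ⟨t₀ - s, by linarith, ?_⟩
  rwa [← hφ.map_add (t₀ - s) s (by linarith) hs.1, sub_add_cancel]

/-- **Upper semicontinuity of the exit time, and `W⁰` is open in `W`, locally**: for `x ∈ W⁰` and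
`ε > 0` there is an open `V ∋ x` all of whose points in `W` lie in `W⁰` and have exit time
`< τ(x) + ε`.  (Some `x·t'`, `t' ≤ τ(x) + ε/2`, is outside `cl W` by condition (a); pull the open
set `(cl W)ᶜ` back by the time-`t'` map.) [cite: Conley1976, §1, proof of Thm. 1.3, pp. 61–63] -/
theorem exists_isOpen_exitTime_lt (hW : IsWazewskiSet φ W) (hφ : IsSemiflow φ)
    (hx : x ∈ eventualExitSet φ W) {ε : ℝ} (hε : 0 < ε) :
    ∃ V : Set X, IsOpen V ∧ x ∈ V ∧ ∀ y ∈ V ∩ W,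
      y ∈ eventualExitSet φ W ∧ exitTime φ W y < exitTime φ W x + ε := by
  set τ := exitTime φ W x with hτ
  have hτ0 : 0 ≤ τ := hφ.exitTime_nonneg hx
  -- some point of `x·[0, τ + ε/2]` is outside `cl W`
  obtain ⟨t', ht', hout⟩ : ∃ t' ∈ Icc 0 (τ + ε / 2), φ t' x ∉ closure W := by
    by_contra h
    push Not at h
    have hmem : τ + ε / 2 ∈ stayTimes φ W x := ⟨by linarith, hW.1 x hx.1 _ (by linarith) h⟩
    have : τ + ε / 2 ≤ τ := by rw [hτ]; exact le_csSup (bddAbove_stayTimes hx) hmem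
    linarith
  have ht'pos : 0 < t' := by
    rcases ht'.1.eq_or_lt with h | h
    · exact absurd (subset_closure (by rw [← h, hφ.map_zero]; exact hx.1)) hout
    · exact h
  refine ⟨φ t' ⁻¹' (closure W)ᶜ, (hφ.continuous_apply ht'.1).isOpen_preimage _
    isClosed_closure.isOpen_compl, hout, fun y hy => ?_⟩
  have hyout : φ t' y ∉ W := fun h => hy.1 (subset_closure h)
  exact ⟨⟨hy.2, t', ht'pos, hyout⟩, (hφ.exitTime_le_of_not_mem hy.2 ht'.1 hyout).trans_lt
    (by linarith [ht'.2])⟩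

/-- **Lower semicontinuity of the exit time on `W⁰`** (the heart of Conley's proof, where
condition (b) enters): for `x ∈ W⁰` and `ε > 0` there is an open `V ∋ x` on whose points
`y ∈ W⁰` the exit time is `> τ(x) - ε`.  (Otherwise let `t̄ < τ(x)` be the infimum of the `t`
such that `x` is a limit of points `y ∈ W⁰` with `τ(y) ≤ t`; by joint continuity the exit points
`y·τ(y) ∈ W⁻` of such `y` accumulate at `x·t̄ ∈ W⁰`, so `x·t̄ ∈ cl(W⁻) ∩ W⁰ ⊆ W⁻` leaves `W`
immediately — before `τ(x)`, a contradiction.) [cite: Conley1976, §1, proof of Thm. 1.3, pp. 61–63] -/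
theorem exists_isOpen_lt_exitTime (hW : IsWazewskiSet φ W) (hφ : IsSemiflow φ)
    (hx : x ∈ eventualExitSet φ W) {ε : ℝ} (hε : 0 < ε) :
    ∃ V : Set X, IsOpen V ∧ x ∈ V ∧ ∀ y ∈ V ∩ eventualExitSet φ W,
      exitTime φ W x - ε < exitTime φ W y := by
  set τ := exitTime φ W x with hτ
  by_contra hcon
  push Not at hcon
  -- `A` = the `t` such that every neighbourhood of `x` contains `y ∈ W⁰` with `τ y ≤ t`
  set A : Set ℝ := {t | ∀ V : Set X, IsOpen V → x ∈ V →
    ∃ y ∈ V ∩ eventualExitSet φ W, exitTime φ W y ≤ t} with hA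
  have hA1 : τ - ε ∈ A := fun V hV hxV => hcon V hV hxV
  have hA0 : ∀ t ∈ A, 0 ≤ t := fun t ht => by
    obtain ⟨y, hy, hyt⟩ := ht univ isOpen_univ (mem_univ _)
    exact (hφ.exitTime_nonneg hy.2).trans hyt
  have hAne : A.Nonempty := ⟨_, hA1⟩
  have hAbdd : BddBelow A := ⟨0, hA0⟩
  set tb := sInf A with htb
  have htb0 : 0 ≤ tb := le_csInf hAne hA0
  have htbτ : tb ≤ τ - ε := csInf_le hAbdd hA1
  -- (P1) above `tb` everything is in `A`; (P2) below `tb` nothing is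
  have hP1 : ∀ t, tb < t → t ∈ A := fun t ht V hV hxV => by
    obtain ⟨a, ha, hat⟩ := exists_lt_of_csInf_lt hAne ht
    obtain ⟨y, hy, hya⟩ := ha V hV hxV
    exact ⟨y, hy, hya.trans hat.le⟩
  have hP2 : ∀ t, t < tb → t ∉ A := fun t ht htA => (not_lt.2 (csInf_le hAbdd htA)) ht
  -- `x·tb ∈ cl(W⁻)`
  have hcl : φ tb x ∈ closure (immediateExitSet φ W) := by
    rw [mem_closure_iff]
    intro O hO hxO
    -- joint continuity at `(tb, x)` within `[0, ∞) × X`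
    have hcont := hφ.continuousWithinAt htb0 x
    have hpre : (fun p : ℝ × X => φ p.1 p.2) ⁻¹' O ∈ 𝓝[Ici 0 ×ˢ univ] (tb, x) :=
      hcont (hO.mem_nhds hxO)
    rw [nhdsWithin_prod_eq, Filter.mem_prod_iff] at hpre
    obtain ⟨T, hT, U', hU', hTU⟩ := hpre
    rw [Metric.mem_nhdsWithin_iff] at hT
    obtain ⟨η, hη, hball⟩ := hT
    rw [nhdsWithin_univ, mem_nhds_iff] at hU'
    obtain ⟨U, hUU', hU, hxU⟩ := hU'
    -- points near `x` with exit time in `(tb - η/2, tb + η/2]`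
    have h2 : ∃ V₂ : Set X, IsOpen V₂ ∧ x ∈ V₂ ∧ ∀ y ∈ V₂ ∩ eventualExitSet φ W,
        tb - η / 2 < exitTime φ W y := by
      by_contra h'
      push Not at h'
      exact hP2 (tb - η / 2) (by linarith) h'
    obtain ⟨V₂, hV₂, hxV₂, hV₂lt⟩ := h2
    obtain ⟨y, hy, hyle⟩ := hP1 (tb + η / 2) (by linarith) (U ∩ V₂) (hU.inter hV₂) ⟨hxU, hxV₂⟩
    have hylt : tb - η / 2 < exitTime φ W y := hV₂lt y ⟨hy.1.2, hy.2⟩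
    refine ⟨φ (exitTime φ W y) y, ?_, hW.apply_exitTime_mem hφ hy.2⟩
    refine hTU (mk_mem_prod (hball ⟨?_, hφ.exitTime_nonneg hy.2⟩) (hUU' hy.1.1))
    rw [Metric.mem_ball, Real.dist_eq, abs_lt]
    constructor <;> linarith
  -- `x·tb ∈ W⁰`, hence `∈ W⁻` by condition (b); but it does not leave before `τ`
  have htbτ' : tb ∈ Icc 0 τ := ⟨htb0, by linarith⟩
  have h0 : φ tb x ∈ eventualExitSet φ W := hW.apply_mem_eventualExitSet hφ hx htbτ'
  have hminus : φ tb x ∈ immediateExitSet φ W := hW.closure_inter_subset ⟨hcl, h0⟩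
  obtain ⟨u, hu, hout⟩ := hminus.2 (τ - tb) (by linarith)
  rw [← hφ.map_add u tb hu.1.le htb0] at hout
  exact hout (hW.mem_of_le_exitTime hφ hx ⟨by linarith [hu.1], by linarith [hu.2]⟩)

/-- **The exit time is continuous on `W⁰`** for a Ważewski set of a semiflow.
[cite: Conley1976, §1, proof of Thm. 1.3, pp. 61–63] -/
theorem continuousOn_exitTime (hW : IsWazewskiSet φ W) (hφ : IsSemiflow φ) :
    ContinuousOn (exitTime φ W) (eventualExitSet φ W) := by
  intro x hx
  rw [ContinuousWithinAt, tendsto_order]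
  constructor
  · intro a ha
    obtain ⟨V, hV, hxV, h⟩ := hW.exists_isOpen_lt_exitTime hφ hx (sub_pos.2 ha)
    rw [eventually_nhdsWithin_iff, eventually_nhds_iff]
    exact ⟨V, fun y hyV hy0 => by simpa using h y ⟨hyV, hy0⟩, hV, hxV⟩
  · intro b hb
    obtain ⟨V, hV, hxV, h⟩ := hW.exists_isOpen_exitTime_lt hφ hx (sub_pos.2 hb)
    rw [eventually_nhdsWithin_iff, eventually_nhds_iff]
    exact ⟨V, fun y hyV hy0 => by simpa using (h y ⟨hyV, hy0.1⟩).2, hV, hxV⟩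

/-- **`W⁰` is open relative to `W`** for a Ważewski set of a semiflow (second half of
Ważewski's theorem: "`W ∖ W⁰` is closed in `W`"). [cite: Conley1976, §1, Thm. 1.3, pp. 61–62] -/
theorem exists_isOpen_inter_eq (hW : IsWazewskiSet φ W) (hφ : IsSemiflow φ) :
    ∃ V : Set X, IsOpen V ∧ V ∩ W = eventualExitSet φ W := by
  refine ⟨⋃₀ {U : Set X | IsOpen U ∧ U ∩ W ⊆ eventualExitSet φ W},
    isOpen_sUnion fun U hU => hU.1, Subset.antisymm ?_ fun x hx => ?_⟩
  · rintro y ⟨⟨U, hU, hyU⟩, hyW⟩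
    exact hU.2 ⟨hyU, hyW⟩
  · obtain ⟨V, hV, hxV, h⟩ := hW.exists_isOpen_exitTime_lt hφ hx one_pos
    exact ⟨⟨V, ⟨hV, fun y hy => (h y hy).1⟩, hxV⟩, hx.1⟩

/-- **Ważewski's theorem** (Conley's statement), for a continuous semiflow: if `W` is a Ważewski
set then `W⁻` is a strong deformation retract of `W⁰`, by the deformation
`(σ, x) ↦ x·(σ τ(x))`, `σ ∈ [0, 1]`. [cite: Conley1976, §1, Thm. 1.3, pp. 61–62] -/
theorem isStrongDeformationRetractOf (hW : IsWazewskiSet φ W) (hφ : IsSemiflow φ) :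
    AlgebraicTopology.Homotopy.IsStrongDeformationRetractOf (immediateExitSet φ W)
      (eventualExitSet φ W) := by
  refine AlgebraicTopology.Homotopy.IsStrongDeformationRetractOf.of_continuousOn
    (fun σ x => φ (σ * exitTime φ W x) x) ?_ ?_ ?_ ?_ ?_
  · have hg : ContinuousOn (fun p : ℝ × X => (p.1 * exitTime φ W p.2, p.2))
        (Icc (0 : ℝ) 1 ×ˢ eventualExitSet φ W) :=
      (continuous_fst.continuousOn.mul ((hW.continuousOn_exitTime hφ).comp
        continuous_snd.continuousOn fun p hp => hp.2)).prodMk continuous_snd.continuousOn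
    exact hφ.continuousOn.comp hg fun p hp =>
      ⟨mul_nonneg hp.1.1 (hφ.exitTime_nonneg hp.2), mem_univ _⟩
  · intro σ hσ x hx
    exact hW.apply_mem_eventualExitSet hφ hx ⟨mul_nonneg hσ.1 (hφ.exitTime_nonneg hx),
      mul_le_of_le_one_left (hφ.exitTime_nonneg hx) hσ.2⟩
  · intro x _
    simp [hφ.map_zero]
  · intro x hx
    simpa using hW.apply_exitTime_mem hφ hx
  · intro σ _ x _ hx
    simp [hφ.exitTime_eq_zero hx, hφ.map_zero]

/-- **Ważewski's principle** (as Conley uses it): for a Ważewski set `W` of a semiflow, if `W⁻`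
is NOT a strong deformation retract of `W`, then `W ∖ W⁰ ≠ ∅` — some point of `W` has its whole
forward orbit in `W`. [cite: Conley1976, §1, remark following the proof of Thm. 1.3, pp. 62–63] -/
theorem exists_forall_mem (hW : IsWazewskiSet φ W) (hφ : IsSemiflow φ)
    (h : ¬ AlgebraicTopology.Homotopy.IsStrongDeformationRetractOf (immediateExitSet φ W) W) :
    ∃ x ∈ W, ∀ t : ℝ, 0 ≤ t → φ t x ∈ W := by
  by_contra hne
  push Not at hne
  have hW0 : eventualExitSet φ W = W := by
    refine Subset.antisymm eventualExitSet_subset fun x hx => ⟨hx, ?_⟩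
    obtain ⟨t, ht, hout⟩ := hne x hx
    rcases ht.eq_or_lt with h0 | hpos
    · exact absurd (by rw [← h0, hφ.map_zero]; exact hx) hout
    · exact ⟨t, hpos, hout⟩
  have hsdr := hW.isStrongDeformationRetractOf hφ
  rw [hW0] at hsdr
  exact h hsdr

end IsWazewskiSet

namespace IsSemiflow

/-- A closed set whose immediate exit set is closed is a Ważewski set. [folklore] -/
theorem isWazewskiSet_of_isClosed (_hφ : IsSemiflow φ) (hWc : IsClosed W)
    (hmc : IsClosed (immediateExitSet φ W)) : IsWazewskiSet φ W :=
  IsWazewskiSet.of_isClosed hWc (by rw [hmc.closure_eq]; exact inter_subset_left)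

/-- **Ważewski's retract principle for continuous semiflows** (the form consumed by route
`AnomalousDissipation/WazewskiBlock`, item `WazewskiRetract`): let `φ` be a continuous semiflow on
a topological space, `W` a closed set whose immediate exit set `W⁻` is closed.  If there is no
retraction of `W` onto `W⁻` (no `r` continuous on `W`, mapping `W` into `W⁻` and fixing `W⁻`
pointwise), then some `x ∈ W` has `φ t x ∈ W` for all `t ≥ 0`.  Proof: otherwise `W⁰ = W` and
`x ↦ x·τ(x)` is such a retraction (continuity of `τ`, Ważewski's theorem).
[cite: Conley1976, §1, Thm. 1.3 and the remark following its proof, pp. 61–63] -/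
theorem exists_forall_mem_of_not_retract (hφ : IsSemiflow φ) (hWc : IsClosed W)
    (hmc : IsClosed (immediateExitSet φ W))
    (h : ¬ ∃ r : X → X, ContinuousOn r W ∧ MapsTo r W (immediateExitSet φ W) ∧
      ∀ x ∈ immediateExitSet φ W, r x = x) :
    ∃ x ∈ W, ∀ t : ℝ, 0 ≤ t → φ t x ∈ W := by
  have hW : IsWazewskiSet φ W := hφ.isWazewskiSet_of_isClosed hWc hmc
  by_contra hne
  push Not at hne
  have hW0 : eventualExitSet φ W = W := by
    refine Subset.antisymm eventualExitSet_subset fun x hx => ⟨hx, ?_⟩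
    obtain ⟨t, ht, hout⟩ := hne x hx
    rcases ht.eq_or_lt with h0 | hpos
    · exact absurd (by rw [← h0, hφ.map_zero]; exact hx) hout
    · exact ⟨t, hpos, hout⟩
  have hmem0 : ∀ x ∈ W, x ∈ eventualExitSet φ W := fun x hx => by rwa [hW0]
  refine h ⟨fun x => φ (exitTime φ W x) x, ?_, fun x hx => ?_, fun x hx => ?_⟩
  · have hτ : ContinuousOn (exitTime φ W) W := by
      have := hW.continuousOn_exitTime hφ
      rwa [hW0] at this
    have hg : ContinuousOn (fun x : X => (exitTime φ W x, x)) W := hτ.prodMk continuousOn_id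
    exact hφ.continuousOn.comp hg fun x hx => ⟨hφ.exitTime_nonneg (hmem0 x hx), mem_univ _⟩
  · exact hW.apply_exitTime_mem hφ (hmem0 x hx)
  · simp only [hφ.exitTime_eq_zero hx, hφ.map_zero]

end IsSemiflow

end Literature.Dynamics.ConleyIndex
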